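import Summits.Ventures.CertifiedManyBodySolver.Theorems.M3x2EdgeSplitSymReplayGramRDecode
import Summits.Ventures.CertifiedManyBodySolver.Theorems.M3x2EdgeSplitSymReplayGramRSoundB
import HarnessLib

/-!
# SymReplay su2R — checker-side SU(2) LOWERING of highest-weight Gram blocks (the BYTE lever «su2R»)
(pen hub-lb-sym-plan-1 g2, 2026-08-28, rev 1; ADDITIVE module on the landed `…SymReplayGramRSyntax` / `…GramRDecode`
(this pen's text, landed by hub-lb-sym-eng-3, p629331 / p633493) — nothing of them is touched; one-writer rule; spec =
hub-lb-sym-eng-4 «WARDFREE/su2R» STATUS l.1489, crit-1 V104 (A) / V105).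

WHY.  The su2avg-lifted E₁-class certificates carry every SU(2) multiplet of Gram basis vectors in FULL: the `2S+1` lowered
copies `Lʲq` (`j = 0 … 2S`) of each highest-weight vector `q`, with identical PSD row data — rows ×2.15, basis bytes ×2.9
(sym-eng-4's census).  su2R ships ONLY the highest-weight data and lets the CHECKER generate the copies:
* §(a) the lowering `L = ad S⁻` (`S⁻ = Σ_x c†_{x↓} c_{x↑}`) as an EXACT LETTER DERIVATION (`S⁻` is even, so no Koszul signs):
  `L c†_{x↑} = c†_{x↓}`, `L c_{x↓} = −c_{x↑}`, `L c†_{x↓} = L c_{x↑} = 0`; `lowerWord` / `lowerPoly` / `lowerStep := collect ∘ lowerPoly`;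
  the raising `R = ad S⁺` likewise (`raisePoly`; `hwOK q := isZero (nfPoly (raisePoly q))` flags a non-highest-weight
  representative — informative only, NOT a soundness condition);
* §(b) `GramBlockS := {scales, moves, reps, rows}` = an R-block (`…GramRSyntax.GramBlockR`) whose single `scale` is replaced by the
  list of scales of its copies (`scales.length = 2S+1`; copy `j` = the R-block `⟨scales[j], moves, reps.map Lʲ, rows⟩`, the
  UNNORMALISED `Lʲ`; the producer divides its multiplet weight by `c_j = ‖Lʲq‖²/‖q‖² = j!(2S)!/(2S−j)!` or whatever its Gram
  normalisation is — the checker takes the scales as DATA and checks `0 ≤ scale` per copy through `wellFormed` of the expansion);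
  `GramBlockS.copies : List GramBlockR`; `SymCertS extends SymCertR` with `gramS`; **`SymCertS.lower : SymCertS → SymCertR`**
  appends all copies to `gramR`.
* SOUNDNESS: NONE NEEDED.  The copies are ordinary R-blocks (PSD rows, nonnegative scales), so EVERY landed R-closing applies to
  `K.lower` verbatim: one call `energyDensity_ge_symValueR K.lower (symCheckR_of_symCheckRV _ h)`, or the sharded / grouped
  `energyDensity_ge_of_shardsRGV K.lower …` of `GramRShardsFast`.  Whether `L` "really is" `ad S⁻` matters only for the identity
  to CLOSE (a convention mismatch with the producer is detected, never unsound); §(d) checks it against the syntactic commutator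
  `comm (spinMinusPoly S) ·` after normal ordering, by kernel `decide`, on doublet / triplet / mixed words.
  (The COST variant — representatives' products only, the copies' Gram facts derived from Ward-null uses `[S⁺, a†·Lb]` — needs an
  SU(2)-invariance lemma inside the proof, crit-1 V104/V106; it is NOT in this module.)
* §(c) TEXT DECODER `decodeSymCertS (toks certS) (toks gramRS) (toks gramSS)`: grammar `gramS := n sblockⁿ`,
  `sblock := nC (p q)ⁿᶜ  nM moveⁿᴹ  nS polyⁿˢ  nR rowⁿᴿ` (`move`/`poly`/`row` as in `…GramRDecode` / `…Decode`).
* §(d) KERNEL REGRESSIONS: doublet `c†_{0↑} ↦ c†_{0↓} ↦ 0`; triplet `c†_{0↑}c†_{e₁↑} ↦ c†_{0↓}c†_{e₁↑} + c†_{0↑}c†_{e₁↓} ↦ 2c†_{0↓}c†_{e₁↓}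
  ↦ 0`; `L` = `[S⁻_S, ·]` after normal order on three words; `hwOK`; and **`toySCert` END TO END**: `…GramRSyntax.toyRCert`'s two
  R-blocks (spin `↑`, `↓`) are the SU(2) doublet `{c_{x↓}, −c_{x↑}}` of ONE highest-weight block — `toySCert` ships that one block
  with `scales = [1/32, 1/32]`, and `toySCert.lower` passes `symCheckRV` and certifies the same `−11/4` (kernel `decide`).

HONEST FRAMING: plumbing for a checker BYTE lever; no real certificate is replayed; no bound of record moves; no summit or crux
statement is proved here; nothing here predicts superconductivity.
-/

namespace Summit.Ventures.CertifiedManyBodySolver.Theorems.SymReplay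

open Literature.Probability.LatticeModels
open Literature.MathematicalPhysics.QuantumLattice
open Literature.MathematicalPhysics.QuantumLattice.HubbardWave0
open Literature.MathematicalPhysics.QuantumLattice.ThermodynamicLimit

/-! ##### (a) The lowering / raising derivations on letters, words, polynomials -/

/-- `[S⁻, ℓ]` for one ladder letter (`S⁻ = Σ_x c†_{x↓} c_{x↑}`): `c†_{x↑} ↦ c†_{x↓}`, `c_{x↓} ↦ −c_{x↑}`, else `0`. -/
def lowerLetter (ℓ : Letter) : QPoly :=
  if ℓ.dag then (if ℓ.s = 0 then [(1, [⟨ℓ.x, 1, true⟩])] else [])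
  else (if ℓ.s = 1 then [(-1, [⟨ℓ.x, 0, false⟩])] else [])

/-- `[S⁺, ℓ]` for one ladder letter (`S⁺ = Σ_x c†_{x↑} c_{x↓}`): `c†_{x↓} ↦ c†_{x↑}`, `c_{x↑} ↦ −c_{x↓}`, else `0`. -/
def raiseLetter (ℓ : Letter) : QPoly :=
  if ℓ.dag then (if ℓ.s = 1 then [(1, [⟨ℓ.x, 0, true⟩])] else [])
  else (if ℓ.s = 0 then [(-1, [⟨ℓ.x, 1, false⟩])] else [])

/-- Extend a letter map to words as a DERIVATION (the generator is even: no signs). -/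
def derivWord (f : Letter → QPoly) : Word → QPoly
  | [] => []
  | ℓ :: w => ((f ℓ).map fun t => (t.1, t.2 ++ w)) ++ (derivWord f w).map fun t => (t.1, ℓ :: t.2)

/-- … and linearly to polynomials. -/
def derivPoly (f : Letter → QPoly) (p : QPoly) : QPoly := p.flatMap fun t => pscale t.1 (derivWord f t.2)

/-- `L p = [S⁻, p]`. -/
def lowerPoly (p : QPoly) : QPoly := derivPoly lowerLetter p

/-- `R p = [S⁺, p]`. -/
def raisePoly (p : QPoly) : QPoly := derivPoly raiseLetter p

/-- One lowering step, collected (equal words merged). -/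
def lowerStep (p : QPoly) : QPoly := collect (lowerPoly p)

/-- `Lʲ p` (collected after each step). -/
def lowerIter : ℕ → QPoly → QPoly
  | 0, p => p
  | j + 1, p => lowerStep (lowerIter j p)

/-- Highest-weight flag: `[S⁺, q]` normal-orders to zero.  Informative (a block whose representatives are not highest weight is
still SOUND — its identity just will not close as the producer intends). -/
def hwOK (q : QPoly) : Bool := isZero (nfPoly (raisePoly q))

/-! ##### (b) SU(2) highest-weight blocks and the expansion `SymCertS.lower` -/

/-- **A highest-weight Gram block**: an R-block whose `scale` is replaced by the scales of its `2S+1` lowered copies. -/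
structure GramBlockS where
  scales : List ℚ
  moves : List RMove
  reps : List QPoly
  rows : List (List (ℚ × ℕ))

/-- The copies `⟨scales[j], moves, Lʲ reps, rows⟩`, `j = 0 … scales.length − 1`, built by iterating `lowerStep` on the
representatives (linear in the number of copies). -/
def copiesFrom (moves : List RMove) (rows : List (List (ℚ × ℕ))) : List QPoly → List ℚ → List GramBlockR
  | _, [] => []
  | reps, s :: ss => ⟨s, moves, reps, rows⟩ :: copiesFrom moves rows (reps.map lowerStep) ss

/-- All lowered copies of a highest-weight block, as ordinary R-blocks. -/
def GramBlockS.copies (B : GramBlockS) : List GramBlockR := copiesFrom B.moves B.rows B.reps B.scales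

/-- `copiesFrom` emits exactly one R-block per shipped scale. -/
theorem length_copiesFrom (moves : List RMove) (rows : List (List (ℚ × ℕ))) :
    ∀ (reps : List QPoly) (ss : List ℚ), (copiesFrom moves rows reps ss).length = ss.length
  | _, [] => rfl
  | reps, s :: ss => by rw [copiesFrom, List.length_cons, length_copiesFrom, List.length_cons]

/-- **An su2R certificate**: an R-certificate plus highest-weight blocks. -/
structure SymCertS extends SymCertR where
  gramS : List GramBlockS

/-- **The expansion**: append every lowered copy to `gramR`.  All R-closings apply to `K.lower`. -/
def SymCertS.lower (K : SymCertS) : SymCertR :=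
  { K.toSymCertR with gramR := K.gramR ++ K.gramS.flatMap GramBlockS.copies }

/-- Lowering keeps the base certificate (frame, value, linear functional, Ward/eom/antiH/slack slots). -/
theorem SymCertS.lower_toSymCert (K : SymCertS) : K.lower.toSymCert = K.toSymCert := rfl

/-- Lowering appends every S-block's copies after the shipped R-blocks. -/
theorem SymCertS.lower_gramR (K : SymCertS) : K.lower.gramR = K.gramR ++ K.gramS.flatMap GramBlockS.copies := rfl

/-- The certified value is the base certificate's (`rfl`). -/
theorem symValueR_lower (K : SymCertS) : symValueR K.lower = symValue K.toSymCert := rfl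

/-- Number of R-blocks after lowering, cheaply. -/
def SymCertS.blockCount (K : SymCertS) : ℕ := K.gramR.length + (K.gramS.map fun B => B.scales.length).sum

/-- The number of copies of a list of S-blocks is the total number of shipped scales. -/
theorem length_flatMap_copies :
    ∀ (L : List GramBlockS), (L.flatMap GramBlockS.copies).length = (L.map fun B => B.scales.length).sum
  | [] => rfl
  | B :: L => by
    rw [List.flatMap_cons, List.length_append, length_flatMap_copies L, List.map_cons, List.sum_cons, GramBlockS.copies,
      length_copiesFrom]

/-- `blockCount` is the R-block count of the lowered certificate (the `n` of `gramR_all_of_facts K.lower n`). -/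
theorem SymCertS.blockCount_eq (K : SymCertS) : K.blockCount = K.lower.gramR.length := by
  rw [SymCertS.blockCount, SymCertS.lower_gramR, List.length_append, length_flatMap_copies]

/-! ##### (c) TEXT DECODER for su2R certificates (readers of `…Decode` / `…GramRDecode` reused by name) -/

/-- Read `n` rationals `(p q)ⁿ`. -/
def rdQs : ℕ → Toks → List ℚ × Toks
  | 0, ts => ([], ts)
  | n + 1, ts => let q := rdQ ts; let r := rdQs n q.2; (q.1 :: r.1, r.2)

/-- Read an S-block `nC (p q)ⁿᶜ nM moveⁿᴹ nS polyⁿˢ nR rowⁿᴿ`. -/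
def rdSBlock (ts : Toks) : GramBlockS × Toks :=
  let cs := rdNat ts
  let s := rdQs cs.1 cs.2
  let cm := rdNat s.2
  let m := rdMoves cm.1 cm.2
  let cb := rdNat m.2
  let b := rdPolys cb.1 cb.2
  let cr := rdNat b.2
  let r := rdRows cr.1 cr.2
  (⟨s.1, m.1, b.1, r.1⟩, r.2)

/-- Read `n` S-blocks. -/
def rdSBlocks : ℕ → Toks → List GramBlockS × Toks
  | 0, ts => ([], ts)
  | n + 1, ts => let b := rdSBlock ts; let r := rdSBlocks n b.2; (b.1 :: r.1, r.2)

/-- Decode a `gramS` text `n sblockⁿ`. -/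
def decodeGramS (ts : Toks) : List GramBlockS := let c := rdNat ts; (rdSBlocks c.1 c.2).1

/-- Tokens left over after a `gramS` text (a well-formed text leaves `0`). -/
def decodeGramSRest (ts : Toks) : ℕ := let c := rdNat ts; (rdSBlocks c.1 c.2).2.length

/-- **Decode an su2R certificate** from the ordinary certificate text, the `gramR` text and the `gramS` text. -/
def decodeSymCertS (ts tsR tsS : Toks) : SymCertS :=
  { toSymCertR := decodeSymCertR ts tsR, gramS := decodeGramS tsS }

/-! ##### (d) Kernel regressions -/

/-- Syntactic equality test used below (`collect`-based; avoids `DecidableEq (Site 2)`). -/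
def peq (p r : QPoly) : Bool := isZero (psub p r)

/-- Doublet: `L c†_{0↑} = c†_{0↓}`, `L² c†_{0↑} = 0`. -/
example : peq (lowerIter 1 [(1, [cre 0 0])]) [(1, [cre 0 1])] = true ∧ isZero (lowerIter 2 [(1, [cre 0 0])]) = true := by
  decide +kernel

/-- Conjugate doublet (the `toyRCert` case): `L c_{0↓} = −c_{0↑}`, `L² c_{0↓} = 0`; `c_{0↓}` is highest weight, `c_{0↑}` is not. -/
example : peq (lowerIter 1 [(1, [ann 0 1])]) [(-1, [ann 0 0])] = true ∧ isZero (lowerIter 2 [(1, [ann 0 1])]) = true ∧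
    hwOK [(1, [ann 0 1])] = true ∧ hwOK [(1, [ann 0 0])] = false := by
  decide +kernel

/-- Triplet: `q = c†_{0↑}c†_{e₁↑}`: `Lq = c†_{0↓}c†_{e₁↑} + c†_{0↑}c†_{e₁↓}`, `L²q = 2 c†_{0↓}c†_{e₁↓}`, `L³q = 0`; `q` is highest weight. -/
example : peq (lowerIter 1 [(1, [cre 0 0, cre e1 0])]) [(1, [cre 0 1, cre e1 0]), (1, [cre 0 0, cre e1 1])] = true ∧
    peq (lowerIter 2 [(1, [cre 0 0, cre e1 0])]) [(2, [cre 0 1, cre e1 1])] = true ∧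
    isZero (lowerIter 3 [(1, [cre 0 0, cre e1 0])]) = true ∧ hwOK [(1, [cre 0 0, cre e1 0])] = true := by
  decide +kernel

/-- The singlet pair `c†_{0↑}c†_{e₁↓} − c†_{0↓}c†_{e₁↑}` is SU(2)-invariant: `L` and `R` kill it (after normal order). -/
example : isZero (nfPoly (lowerPoly [(1, [cre 0 0, cre e1 1]), (-1, [cre 0 1, cre e1 0])])) = true ∧
    hwOK [(1, [cre 0 0, cre e1 1]), (-1, [cre 0 1, cre e1 0])] = true := by
  decide +kernel

/-- `L` IS `[S⁻_S, ·]` and `R` IS `[S⁺_S, ·]` after normal ordering (`S ⊇` the support), on a triplet, a mixed and a degree-3 word. -/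
example : (([[(1, [cre 0 0, cre e1 0])], [(1, [cre 0 0, ann e1 1])], [(1, [cre 0 0, cre e1 1, ann e1 0])]] : List QPoly).all
      fun p => isZero (psub (nfPoly (lowerPoly p)) (nfPoly (comm (spinMinusPoly bond2) p))) &&
        isZero (psub (nfPoly (raisePoly p)) (nfPoly (comm (spinPlusPoly bond2) p)))) = true := by
  decide +kernel

/-- **`toySCert`**: `toyRCert` with its two spin-labelled R-blocks replaced by ONE highest-weight block (the `↓` annihilator
doublet member) and the scales of its two copies. -/
def toySCert : SymCertS :=
  { toSymCertR := { toyRCert with gramR := [] },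
    gramS := [{ scales := [1 / 32, 1 / 32], moves := d4MovesTriv, reps := [[(1, [ann 0 1]), (-1, [ann e1 1])]],
                rows := [[(1, 0)]] }] }

/-- The expansion has the two copies (`blockCount` = 2, cheaply and truly). -/
example : toySCert.blockCount = 2 ∧ toySCert.lower.gramR.length = 2 := by decide +kernel

/-- Copy 1's representative is `−(toyRCert's ↑ representative)` (the sign squares away in the Gram polynomial). -/
example : (toySCert.lower.gramR.map fun B => B.reps.map fun q => peq q [(-1, [ann 0 0]), (1, [ann e1 0])]) =
    [[false], [true]] := by decide +kernel

/-- **END TO END (kernel)**: the lowered toy passes the executed R-checker and certifies `−11/4 ≤ e(TL)` through the landed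
one-call R-closing — no su2R-specific soundness text exists or is needed. -/
theorem toySCert_checkV : symCheckRV toySCert.lower = true := by decide +kernel

/-- The lowered toy S-certificate carries `toyRCert`'s value `-11/4`. -/
theorem toySCert_value : symValueR toySCert.lower = (-11) / 4 := by decide +kernel

/-- END TO END: the toy S-certificate, lowered, bounds the energy density through the landed R-closing `energyDensity_ge_symValueR`. -/
theorem toySCert_energy_ge : ((symValueR toySCert.lower : ℚ) : ℝ) ≤ energyDensityTT' 1 0 8 (7 / 8) :=
  energyDensity_ge_symValueR toySCert.lower (symCheckR_of_symCheckRV _ toySCert_checkV)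

/-- The `gramS` text of `toySCert` (grammar §(c)): `1` block · `2` scales `1/32 1/32` · `8` trivial-translation moves `k 0 0 1/1` ·
`1` representative of `2` terms · `1` row `[(1,0)]`. -/
def toySToks : Toks :=
  [1, 2, 1, 32, 1, 32, 8, 0, 0, 0, 1, 1, 1, 0, 0, 1, 1, 2, 0, 0, 1, 1, 3, 0, 0, 1, 1, 4, 0, 0, 1, 1, 5, 0, 0, 1, 1,
    6, 0, 0, 1, 1, 7, 0, 0, 1, 1, 1, 2, 1, 1, 1, 0, 0, 1, 0, -1, 1, 1, 1, 0, 1, 0, 1, 1, 1, 0]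

/-- The text grammar round-trips: no tokens left over, and the DECODED S-block, lowered, passes the executed R-checker. -/
example : decodeGramSRest toySToks = 0 ∧ symCheckRV ({ toySCert with gramS := decodeGramS toySToks }).lower = true := by
  decide +kernel

end Summit.Ventures.CertifiedManyBodySolver.Theorems.SymReplay
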